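import Summits.BirchSwinnertonDyer.BirchSwinnertonDyer.Theorems.ManinLocalTwoThreeNineShiftTowerReduction
import HarnessLib

/-!
# The 3-shift descent engine, I: quadruple calculus in `Γ₀(M)` and the abstract gluing of a compatible pair of characters
# (route `ManinLocalTwoThree`, cell bsd-f2-manin; crux C3 `ManinPrimeToThreeAtNine` stmt-BirchSwinnertonDyer-22968; prover seat p3
# gen 10, es ask P-es-2)

Toolkit for the sibling `…ThreeShiftDescentEngine.lean`, which proves the DESCENT step of es's THEOREMS III / III′
(`NineShiftEqualiser.ThreeShiftTowerDescent` / `ThreeShiftAntiInvariantDescent`, MEMO-es §37.8) WITHOUT Bass–Serre theory or a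
Heisenberg lift:
* §1 explicit matrices `g0Of a b c d` of `Γ₀(M)` (tree vocabulary of `NineShiftEqualiserLaw.lean`): products (`g0Of_mul`), the
  unipotent `Tpow M k = (1 k; 0 1)` and conjugation by it;
* §2 at a level `3 ∣ M`: `a ≡ d`, `a² ≡ 1 (mod 3)` for `(a b; c d) ∈ Γ₀(M)` (`three_dvd_of_det`) and the TRICHOTOMY behind the
  statement «`Q₁` generates `A/(A ∩ B)`»;
* §3 ABSTRACT GLUING in any group `G` with `A ⊴ G`, `B ≤ G`: an additive `α` on `A` and an additive `φ` on `B` agreeing on `A ∩ B`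
  glue to an additive `w` on `G = A·⟨t⟩` (`glue`, `w(g) = α(g t^{−n(g)}) + n(g) φ(t)`) as soon as `α` is invariant under conjugation by
  `t ∈ B`; and that invariance follows from ONE instance `α(t q t⁻¹) = α(q)` when `q` generates `A` modulo `A ∩ B`
  (`conj_invariant_of_generator` — the defect `a ↦ α(tat⁻¹) − α(a)` is additive on `A` and vanishes on `A ∩ B`).
Nothing about BSD, Manin's conjecture or the laws E-es-94♯/96–101 is asserted here.  References: cell memo HOME/MEMO-es.md §37.8;
H. Darmon, F. Diamond, R. Taylor, *Fermat's Last Theorem* (1995), Lemma 4.28 (degeneracy maps on `Γ₀`) [cite: DarmonDiamondTaylor1995, Lemma 4.28 (p. 135)].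
-/

set_option autoImplicit false
set_option linter.dupNamespace false

open scoped MatrixGroups

open CongruenceSubgroup Matrix.SpecialLinearGroup
  Summit.BirchSwinnertonDyer.Rank1Residual.ManinAdditive.NineShiftEqualiser

namespace Summit.BirchSwinnertonDyer.BirchSwinnertonDyer.Theorems.ManinLocalTwoThree

namespace ThreeShiftDescent

/-! ### §1. Entries, products and the unipotent `T` in `Γ₀(M)` -/

section Basic

variable {M : ℕ}

/-- Entries of `g0Of`. [folklore] -/
theorem g0Of_apply (a b c d : ℤ) (h : a * d - b * c = 1) (hc : (M : ℤ) ∣ c) :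
    (((g0Of a b c d h hc : Gamma0 M) : SL(2, ℤ)) 0 0 : ℤ) = a ∧
    (((g0Of a b c d h hc : Gamma0 M) : SL(2, ℤ)) 0 1 : ℤ) = b ∧
    (((g0Of a b c d h hc : Gamma0 M) : SL(2, ℤ)) 1 0 : ℤ) = c ∧
    (((g0Of a b c d h hc : Gamma0 M) : SL(2, ℤ)) 1 1 : ℤ) = d := ⟨rfl, rfl, rfl, rfl⟩

/-- **Product of two explicit matrices.** [folklore] -/
theorem g0Of_mul (a b c d a' b' c' d' : ℤ) (h : a * d - b * c = 1) (hc : (M : ℤ) ∣ c)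
    (h' : a' * d' - b' * c' = 1) (hc' : (M : ℤ) ∣ c')
    (h'' : (a * a' + b * c') * (c * b' + d * d') - (a * b' + b * d') * (c * a' + d * c') = 1)
    (hc'' : (M : ℤ) ∣ c * a' + d * c') :
    (g0Of a b c d h hc * g0Of a' b' c' d' h' hc' : Gamma0 M) =
      g0Of (a * a' + b * c') (a * b' + b * d') (c * a' + d * c') (c * b' + d * d') h'' hc'' := by
  apply Subtype.ext
  ext i j
  fin_cases i <;> fin_cases j <;> simp [g0Of, slOf, Matrix.mul_apply, Fin.sum_univ_two]

/-- The determinant of a product of explicit matrices (for use with `g0Of_mul`). [folklore] -/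
theorem det_mul_entries {a b c d a' b' c' d' : ℤ} (h : a * d - b * c = 1) (h' : a' * d' - b' * c' = 1) :
    (a * a' + b * c') * (c * b' + d * d') - (a * b' + b * d') * (c * a' + d * c') = 1 := by
  linear_combination (a' * d' - b' * c') * h + h'

/-- The unipotent `T^k = (1 k; 0 1) ∈ Γ₀(M)`. [folklore] -/
def Tpow (M : ℕ) (k : ℤ) : Gamma0 M := g0Of 1 k 0 1 (by ring) (dvd_zero _)

/-- `T^j T^k = T^{j+k}`. [folklore] -/
theorem Tpow_mul_Tpow (j k : ℤ) : (Tpow M j * Tpow M k : Gamma0 M) = Tpow M (j + k) := by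
  unfold Tpow
  rw [g0Of_mul 1 j 0 1 1 k 0 1 _ _ _ _ (by ring) (by simp)]
  exact g0Of_congr (by ring) (by ring) (by ring) (by ring) _ _ _ _

/-- `T^0 = 1`. [folklore] -/
theorem Tpow_zero : (Tpow M 0 : Gamma0 M) = 1 := by
  apply Subtype.ext
  ext i j
  fin_cases i <;> fin_cases j <;> simp [Tpow, g0Of, slOf]

/-- `(T^k)⁻¹ = T^{-k}`. [folklore] -/
theorem Tpow_inv (k : ℤ) : (Tpow M k : Gamma0 M)⁻¹ = Tpow M (-k) := by
  rw [inv_eq_iff_mul_eq_one, Tpow_mul_Tpow, add_neg_cancel, Tpow_zero]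

/-- Right multiplication by `T^k`: `(a b; c d) T^k = (a, ak + b; c, ck + d)`. [folklore] -/
theorem g0Of_mul_Tpow (a b c d : ℤ) (h : a * d - b * c = 1) (hc : (M : ℤ) ∣ c) (k : ℤ)
    (h' : a * (c * k + d) - (a * k + b) * c = 1) :
    (g0Of a b c d h hc * Tpow M k : Gamma0 M) = g0Of a (a * k + b) c (c * k + d) h' hc := by
  unfold Tpow
  rw [g0Of_mul a b c d 1 k 0 1 h hc _ _ (by linear_combination h) (by simpa using hc)]
  exact g0Of_congr (by ring) (by ring) (by ring) (by ring) _ _ _ _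

/-- Conjugation by `T`: `T (a b; c d) T⁻¹ = (a + c, b + d − a − c; c, d − c)`. [folklore] -/
theorem Tpow_one_mul_mul_Tpow_neg_one (a b c d : ℤ) (h : a * d - b * c = 1) (hc : (M : ℤ) ∣ c)
    (h' : (a + c) * (d - c) - (b + d - a - c) * c = 1) :
    (Tpow M 1 * g0Of a b c d h hc * Tpow M (-1) : Gamma0 M) = g0Of (a + c) (b + d - a - c) c (d - c) h' hc := by
  unfold Tpow
  rw [g0Of_mul 1 1 0 1 a b c d _ _ h hc (by linear_combination h) (by simpa using hc),
    g0Of_mul _ _ _ _ 1 (-1) 0 1 _ _ _ _ (by linear_combination h) (by simpa using hc)]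
  exact g0Of_congr (by ring) (by ring) (by ring) (by ring) _ _ _ _

end Basic

/-! ### §2. Mod-3 facts at a level divisible by 3 -/

section ModThree

variable {M : ℕ}

/-- For `(a b; c d) ∈ Γ₀(M)` with `3 ∣ M`: `3 ∣ d − a` and `3 ∣ a·a − 1` (as `ad ≡ 1`, `c ≡ 0 (mod 3)`). [folklore] -/
theorem three_dvd_of_det (h3 : 3 ∣ M) {a b c d : ℤ} (h : a * d - b * c = 1) (hc : (M : ℤ) ∣ c) :
    (3 : ℤ) ∣ d - a ∧ (3 : ℤ) ∣ a * a - 1 ∧ (3 : ℤ) ∣ d * d - 1 := by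
  have hc3 : ((c : ℤ) : ZMod 3) = 0 :=
    (ZMod.intCast_zmod_eq_zero_iff_dvd c 3).mpr ((Int.natCast_dvd_natCast.mpr h3).trans hc)
  have had : ((a : ℤ) : ZMod 3) * (d : ZMod 3) = 1 := by
    have := congrArg (fun x : ℤ => (x : ZMod 3)) h
    push_cast at this
    rw [hc3, mul_zero, sub_zero] at this
    exact this
  have key : ∀ x y : ZMod 3, x * y = 1 → y - x = 0 ∧ x * x - 1 = 0 ∧ y * y - 1 = 0 := by decide
  obtain ⟨h1, h2, h3'⟩ := key _ _ had
  refine ⟨?_, ?_, ?_⟩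
  · exact (ZMod.intCast_zmod_eq_zero_iff_dvd _ 3).mp (by push_cast; exact h1)
  · exact (ZMod.intCast_zmod_eq_zero_iff_dvd _ 3).mp (by push_cast; exact h2)
  · exact (ZMod.intCast_zmod_eq_zero_iff_dvd _ 3).mp (by push_cast; exact h3')

/-- Trichotomy for the `Q₁`-decomposition: with `3 ∣ M`, `c = M c₀`, `ad − bc = 1`, one of `c₀`, `c₀ − c − d`,
`c₀ + c + d` is divisible by `3`. [folklore] -/
theorem trichotomy (h3 : 3 ∣ M) {a b c d c₀ : ℤ} (h : a * d - b * c = 1) (hc₀ : c = M * c₀) :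
    (3 : ℤ) ∣ c₀ ∨ (3 : ℤ) ∣ c₀ - c - d ∨ (3 : ℤ) ∣ c₀ + c + d := by
  have hc3 : ((c : ℤ) : ZMod 3) = 0 :=
    (ZMod.intCast_zmod_eq_zero_iff_dvd c 3).mpr ((Int.natCast_dvd_natCast.mpr h3).trans ⟨c₀, hc₀⟩)
  have had : ((a : ℤ) : ZMod 3) * (d : ZMod 3) = 1 := by
    have := congrArg (fun x : ℤ => (x : ZMod 3)) h
    push_cast at this
    rw [hc3, mul_zero, sub_zero] at this
    exact this
  have key : ∀ x y z : ZMod 3, x * y = 1 → (z = 0 ∨ z - 0 - y = 0 ∨ z + 0 + y = 0) := by decide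
  rcases key _ _ ((c₀ : ℤ) : ZMod 3) had with h0 | h0 | h0
  · exact Or.inl ((ZMod.intCast_zmod_eq_zero_iff_dvd _ 3).mp h0)
  · refine Or.inr (Or.inl ((ZMod.intCast_zmod_eq_zero_iff_dvd _ 3).mp ?_))
    push_cast; rw [hc3]; exact h0
  · refine Or.inr (Or.inr ((ZMod.intCast_zmod_eq_zero_iff_dvd _ 3).mp ?_))
    push_cast; rw [hc3]; exact h0

end ModThree

end ThreeShiftDescent

end Summit.BirchSwinnertonDyer.BirchSwinnertonDyer.Theorems.ManinLocalTwoThree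

namespace Summit.BirchSwinnertonDyer.BirchSwinnertonDyer.Theorems.ManinLocalTwoThree

namespace ThreeShiftDescent

/-! ### §3. Abstract gluing of a compatible pair of characters along `G = A·⟨t⟩` -/

section Abstract

variable {G : Type*} [Group G] {Z : Type*} [AddCommGroup Z]

/-- An additive function on a subgroup kills `1`. [folklore] -/
theorem addOn_map_one {H : Subgroup G} {f : G → Z} (hf : ∀ x ∈ H, ∀ y ∈ H, f (x * y) = f x + f y) : f 1 = 0 := by
  have h := hf 1 H.one_mem 1 H.one_mem
  rw [mul_one] at h
  have : f 1 + f 1 - f 1 = f 1 - f 1 := by rw [← h]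
  simpa using this

/-- An additive function on a subgroup is odd. [folklore] -/
theorem addOn_map_inv {H : Subgroup G} {f : G → Z} (hf : ∀ x ∈ H, ∀ y ∈ H, f (x * y) = f x + f y) {x : G}
    (hx : x ∈ H) : f x⁻¹ = - f x := by
  have h := hf x hx x⁻¹ (H.inv_mem hx)
  rw [mul_inv_cancel, addOn_map_one hf] at h
  exact eq_neg_of_add_eq_zero_right h.symm

/-- An additive function on a subgroup on integer powers. [folklore] -/
theorem addOn_map_zpow {H : Subgroup G} {f : G → Z} (hf : ∀ x ∈ H, ∀ y ∈ H, f (x * y) = f x + f y) {x : G}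
    (hx : x ∈ H) (n : ℤ) : f (x ^ n) = n • f x := by
  induction n using Int.induction_on with
  | zero => rw [zpow_zero, addOn_map_one hf, zero_smul]
  | succ n ih =>
      rw [zpow_add_one, hf _ (H.zpow_mem hx n) x hx, ih, add_smul, one_smul]
  | pred n ih =>
      rw [zpow_sub_one, hf _ (H.zpow_mem hx _) _ (H.inv_mem hx), ih, addOn_map_inv hf hx, sub_smul, one_smul,
        sub_eq_add_neg]

/-- **Conjugation invariance from one generator** (the `κ`-lemma).  Let `A ⊴ G`, `B ≤ G`, `α` additive on `A`, `φ`
additive on `B`, `α = φ` on `A ∩ B`, `t ∈ B`, and `q ∈ A` such that every `a ∈ A` has `a q^{-e} ∈ B` for some `e ∈ ℤ`.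
If `α(t q t⁻¹) = α(q)` then `α(t a t⁻¹) = α(a)` for every `a ∈ A`: the defect `a ↦ α(tat⁻¹) − α(a)` is additive on `A`,
vanishes on `A ∩ B`, and `A/(A ∩ B)` is generated by `q`. [folklore] -/
theorem conj_invariant_of_generator {A B : Subgroup G} (hA : A.Normal) {α φ : G → Z}
    (hα : ∀ x ∈ A, ∀ y ∈ A, α (x * y) = α x + α y) (hφ : ∀ x ∈ B, ∀ y ∈ B, φ (x * y) = φ x + φ y)
    (hC : ∀ x ∈ A, x ∈ B → α x = φ x) {t : G} (ht : t ∈ B) {q : G} (hq : q ∈ A)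
    (hgen : ∀ a ∈ A, ∃ e : ℤ, a * q ^ (-e) ∈ B) (hκ : α (t * q * t⁻¹) = α q) :
    ∀ a ∈ A, α (t * a * t⁻¹) = α a := by
  intro a ha
  obtain ⟨e, he⟩ := hgen a ha
  set c := a * q ^ (-e) with hc
  have hcA : c ∈ A := A.mul_mem ha (A.zpow_mem hq _)
  have ha' : a = c * q ^ e := by rw [hc, mul_assoc, ← zpow_add, neg_add_cancel, zpow_zero, mul_one]
  -- `α(t c t⁻¹) = α(c)` for `c ∈ A ∩ B`
  have htct : t * c * t⁻¹ ∈ A := hA.conj_mem c hcA t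
  have htctB : t * c * t⁻¹ ∈ B := B.mul_mem (B.mul_mem ht he) (B.inv_mem ht)
  have h1 : α (t * c * t⁻¹) = α c := by
    rw [hC _ htct htctB, hC _ hcA he, hφ _ (B.mul_mem ht he) _ (B.inv_mem ht), hφ _ ht _ he, addOn_map_inv hφ ht]
    abel
  -- `α(t q^e t⁻¹) = α(q^e)`
  have h2 : α (t * q ^ e * t⁻¹) = α (q ^ e) := by
    have e1 : t * q ^ e * t⁻¹ = (t * q * t⁻¹) ^ e := by rw [conj_zpow]
    rw [e1, addOn_map_zpow hα (hA.conj_mem q hq t) e, hκ, ← addOn_map_zpow hα hq e]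
  -- assemble
  have e2 : t * a * t⁻¹ = (t * c * t⁻¹) * (t * q ^ e * t⁻¹) := by rw [ha']; group
  rw [e2, hα _ htct _ (hA.conj_mem _ (A.zpow_mem hq e) t), h1, h2, ← hα _ hcA _ (A.zpow_mem hq e), ← ha']

omit [AddCommGroup Z] in
/-- Conjugation invariance by `t` implies invariance by every power `t^k`. [folklore] -/
theorem conj_zpow_invariant {A : Subgroup G} (hA : A.Normal) {α : G → Z} {t : G}
    (hinv : ∀ a ∈ A, α (t * a * t⁻¹) = α a) (k : ℤ) : ∀ a ∈ A, α (t ^ k * a * (t ^ k)⁻¹) = α a := by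
  induction k using Int.induction_on with
  | zero => intro a _; simp
  | succ n ih =>
      intro a ha
      have e : t ^ ((n : ℤ) + 1) * a * (t ^ ((n : ℤ) + 1))⁻¹ = t ^ (n : ℤ) * (t * a * t⁻¹) * (t ^ (n : ℤ))⁻¹ := by
        group
      rw [e, ih _ (hA.conj_mem a ha t), hinv a ha]
  | pred n ih =>
      intro a ha
      have hinv' : ∀ a ∈ A, α (t⁻¹ * a * t) = α a := by
        intro a ha
        have := hinv (t⁻¹ * a * t) (by simpa using hA.conj_mem a ha t⁻¹)
        rw [← this]
        congr 1
        group
      have e : t ^ (-(n : ℤ) - 1) * a * (t ^ (-(n : ℤ) - 1))⁻¹ = t ^ (-(n : ℤ)) * (t⁻¹ * a * t) * (t ^ (-(n : ℤ)))⁻¹ := by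
        group
      rw [e, ih _ (by simpa using hA.conj_mem a ha t⁻¹), hinv' a ha]

/-- **Gluing a compatible pair.**  Let `A ⊴ G`, `B ≤ G`, `α` additive on `A` and invariant under conjugation by `t ∈ B`,
`φ` additive on `B`, `α = φ` on `A ∩ B`, and `n : G → ℤ` with `g · t^{−n(g)} ∈ A` for all `g` and `t^{n(a)} ∈ A` for
`a ∈ A`.  Then `w(g) := α(g t^{−n(g)}) + n(g)·φ(t)` is additive on `G`, restricts to `α` on `A` and to `φ` on `B`.
[folklore] -/
theorem glue {A B : Subgroup G} (hA : A.Normal) {α φ : G → Z}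
    (hα : ∀ x ∈ A, ∀ y ∈ A, α (x * y) = α x + α y) (hφ : ∀ x ∈ B, ∀ y ∈ B, φ (x * y) = φ x + φ y)
    (hC : ∀ x ∈ A, x ∈ B → α x = φ x) {t : G} (ht : t ∈ B) (hinv : ∀ a ∈ A, α (t * a * t⁻¹) = α a)
    (n : G → ℤ) (hn : ∀ g, g * t ^ (-(n g)) ∈ A) (hnA : ∀ a ∈ A, t ^ (n a) ∈ A) :
    (∀ g h, (α (g * h * t ^ (-(n (g * h)))) + n (g * h) • φ t) =
        (α (g * t ^ (-(n g))) + n g • φ t) + (α (h * t ^ (-(n h))) + n h • φ t)) ∧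
      (∀ a ∈ A, α (a * t ^ (-(n a))) + n a • φ t = α a) ∧
      (∀ b ∈ B, α (b * t ^ (-(n b))) + n b • φ t = φ b) := by
  have hzC : ∀ j : ℤ, t ^ j ∈ A → α (t ^ j) = j • φ t := fun j hj => by
    rw [hC _ hj (B.zpow_mem ht j), addOn_map_zpow hφ ht]
  refine ⟨?_, ?_, ?_⟩
  · intro g h
    set x := g * t ^ (-(n g)) with hx
    set y := h * t ^ (-(n h)) with hy
    have hxA : x ∈ A := hn g
    have hyA : y ∈ A := hn h
    set j : ℤ := n g + n h - n (g * h) with hj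
    have hconj : t ^ (n g) * y * (t ^ (n g))⁻¹ ∈ A := hA.conj_mem y hyA _
    have e : g * h * t ^ (-(n (g * h))) = x * (t ^ (n g) * y * (t ^ (n g))⁻¹) * t ^ j := by
      rw [hx, hy, hj]; group
    have htj : t ^ j ∈ A := by
      have : t ^ j = (x * (t ^ (n g) * y * (t ^ (n g))⁻¹))⁻¹ * (g * h * t ^ (-(n (g * h)))) := by
        rw [e]; group
      rw [this]
      exact A.mul_mem (A.inv_mem (A.mul_mem hxA hconj)) (hn (g * h))
    rw [e, hα _ (A.mul_mem hxA hconj) _ htj, hα _ hxA _ hconj, conj_zpow_invariant hA hinv (n g) y hyA,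
      hzC j htj, hj]
    simp only [sub_smul, add_smul]
    abel
  · intro a ha
    have h1 : t ^ (-(n a)) ∈ A := by rw [zpow_neg]; exact A.inv_mem (hnA a ha)
    rw [hα _ ha _ h1, hzC _ h1, neg_smul]
    abel
  · intro b hb
    have h1 : b * t ^ (-(n b)) ∈ B := B.mul_mem hb (B.zpow_mem ht _)
    rw [hC _ (hn b) h1, hφ _ hb _ (B.zpow_mem ht _), addOn_map_zpow hφ ht, neg_smul]
    abel

end Abstract

end ThreeShiftDescent

end Summit.BirchSwinnertonDyer.BirchSwinnertonDyer.Theorems.ManinLocalTwoThree
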